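/-
Copyright (c) 2026. All rights reserved.
Released under Apache 2.0 license as described in the file LICENSE.
Authors: abc-iut cell, prover seat abc-iut-w5-d210 (wave 5, D-0068; NV-L4 row).
-/
import Literature.AnabelianGeometry.AbsoluteAnabelian.MonoAnalyticArchModelProofs
import Literature.AnabelianGeometry.AbsoluteAnabelian.TMMonoGroupoid
import Literature.AnabelianGeometry.AbsoluteAnabelian.PanalocalTheaters
import Mathlib.Topology.Homeomorph.Lemmas
import HarnessLib

/-!
# [AbsTopIII] Definition 5.6 (i)/(ii): the category `TM⊢` is NON-EMPTY — the archimedean model object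

S. Mochizuki, *Topics in absolute anabelian geometry III: global reconstruction algorithms*,
J. Math. Sci. Univ. Tokyo 22 (2015) 939–1156 [MochizukiAbsTopIII2015], Def 5.6 (i) (manuscript p. 134):
"`TM⊢`: pairs `(C, C⃗)` of a topological monoid `C` isomorphic to `𝒪_ℂ^▷` and a topological submonoid
`C⃗ ⊆ C` [necessarily isomorphic to `ℝ_{≥0}`] such that the natural inclusions `C^× ↪ C`, `C⃗ ↪ C` determine
an isomorphism `C^× × C⃗ ⥲ C` of topological monoids"; Def 5.6 (ii)(c) (p. 135): the mono-analyticization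
`X ↦ (𝒪^▷_{A_X}, 𝒪^▷_{A_X} ∩ ℝ_{>0}) ∈ Ob(TM⊢)` of an Aut-holomorphic orbispace.

PROOF-ONLY non-vacuity companion (abc-iut NV-L4 row «TMMono», «ArchMonoAnalyticization»; kernel censuses
abc-iut-w5-d056 v3 / abc-iut-w5-d197 L4-v1: 45 resp. 28 consumers, zero producers) to the LANDED statement file
`MonoAnalyticLogShells.lean` (typer abc-iut-L4-t3, p404450 — not edited) and `PanalocalTheaters.lean`.
Declares NO `def` / `instance` / `structure`: every witness is built inside a theorem term.

* `TMMono.nonempty_model` — GENUINE MODEL: the object `(𝒪_ℂ^▷, 𝒪_ℂ^▷ ∩ ℝ_{>0})` itself, i.e.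
  `C := complexIntegralMonoid = {z ∈ ℂ : 0 < ‖z‖ ≤ 1}` (the typer's own definition, with its subspace
  topology and monoid structure), `C⃗ := {z ∈ C : z ∈ ℝ_{>0}} = (0, 1]`, `C ≅ 𝒪_ℂ^▷` the identity, and the
  printed clause `C^× × C⃗ ⥲ C` PROVED: the units of `𝒪_ℂ^▷` are the unit circle
  (`norm_eq_one_of_mul_eq_one`, MonoAnalyticArchModelProofs.lean), and the polar decomposition
  `z ↦ (z/‖z‖, ‖z‖)` is a continuous two-sided inverse of `(u, t) ↦ u·t` (continuity into `C^×` for the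
  `Units` topology via `Units.continuous_iff`, the inverse unit being `‖z‖/z`).
* `ArchMonoAnalyticization.nonempty_degenerate` — DEGENERATE (honestly labelled): the CONSTANT assignment
  `X ↦ M₀` (a fixed object of `TM⊢`, inhabited by the previous theorem), `(X ≅ Y) ↦ id_{M₀}`. The genuine
  Def 5.6 (ii)(c) functor `X ↦ (𝒪^▷_{A_X}, 𝒪^▷_{A_X} ∩ ℝ_{>0})` needs the identification `A_X ≅ ℂ` (Cor 2.9) as
  DATA on the stub `AutHolOrbispace` (GaloisTheaters.lean), which records `A_X` only as an abstract
  topological field — TODO-merge abc-iut-L4-t2 (owner of `EA`); for the intended objects (`A_X ≅ ℂ`) the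
  constant value IS the printed one.

Classical complex analysis only; no named fact is consumed or introduced. Refereed pre-IUT anabelian geometry;
nothing here bears on [IUTchIII] Cor. 3.12; typed ≠ proved; instantiated ≠ endorsed.
-/

set_option autoImplicit false

open Complex

namespace Literature.AnabelianGeometry.AbsoluteAnabelian

/-! ## Elementary facts about `𝒪_ℂ^▷ = {0 < ‖z‖ ≤ 1}` -/

/-- Membership in `𝒪_ℂ^▷` unfolded: `0 < ‖z‖ ≤ 1`. [cite: MochizukiAbsTopIII2015, Def 5.6 (i) p. 134] -/
theorem mem_complexIntegralMonoid_iff {z : ℂ} : z ∈ complexIntegralMonoid ↔ 0 < ‖z‖ ∧ ‖z‖ ≤ 1 :=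
  Iff.rfl

/-- An element of `𝒪_ℂ^▷` has positive norm. [cite: MochizukiAbsTopIII2015, Def 5.6 (i) p. 134] -/
theorem complexIntegralMonoid.norm_pos (x : complexIntegralMonoid) : 0 < ‖(x : ℂ)‖ :=
  (mem_complexIntegralMonoid_iff.1 x.2).1

/-- An element of `𝒪_ℂ^▷` has norm at most `1`. [cite: MochizukiAbsTopIII2015, Def 5.6 (i) p. 134] -/
theorem complexIntegralMonoid.norm_le_one (x : complexIntegralMonoid) : ‖(x : ℂ)‖ ≤ 1 :=
  (mem_complexIntegralMonoid_iff.1 x.2).2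

/-- An element of `𝒪_ℂ^▷` is a nonzero complex number. [cite: MochizukiAbsTopIII2015, Def 5.6 (i) p. 134] -/
theorem complexIntegralMonoid.coe_ne_zero (x : complexIntegralMonoid) : (x : ℂ) ≠ 0 :=
  norm_pos_iff.1 (complexIntegralMonoid.norm_pos x)

/-- The norm of an element of `𝒪_ℂ^▷`, read in `ℂ`, is nonzero. [cite: MochizukiAbsTopIII2015, Def 5.6 (i) p. 134] -/
theorem complexIntegralMonoid.ofReal_norm_ne_zero (x : complexIntegralMonoid) : ((‖(x : ℂ)‖ : ℝ) : ℂ) ≠ 0 :=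
  Complex.ofReal_ne_zero.2 (complexIntegralMonoid.norm_pos x).ne'

/-- A real number `0 < r ≤ 1` lies in `𝒪_ℂ^▷` (the ray `𝒪_ℂ^▷ ∩ ℝ_{>0} = (0, 1]`).
[cite: MochizukiAbsTopIII2015, Def 5.6 (i) p. 134] -/
theorem ofReal_mem_complexIntegralMonoid {r : ℝ} (h0 : 0 < r) (h1 : r ≤ 1) :
    (r : ℂ) ∈ complexIntegralMonoid := by
  rw [mem_complexIntegralMonoid_iff, Complex.norm_of_nonneg h0.le]
  exact ⟨h0, h1⟩

/-- The radial part `‖z‖` of `z ∈ 𝒪_ℂ^▷` lies in `𝒪_ℂ^▷`. [cite: MochizukiAbsTopIII2015, Def 5.6 (i) p. 134] -/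
theorem norm_mem_complexIntegralMonoid (x : complexIntegralMonoid) :
    ((‖(x : ℂ)‖ : ℝ) : ℂ) ∈ complexIntegralMonoid :=
  ofReal_mem_complexIntegralMonoid (complexIntegralMonoid.norm_pos x) (complexIntegralMonoid.norm_le_one x)

/-- The angular part `z/‖z‖` of `z ∈ 𝒪_ℂ^▷` lies in `𝒪_ℂ^▷` (on the unit circle).
[cite: MochizukiAbsTopIII2015, Def 5.6 (i) p. 134] -/
theorem div_norm_mem_complexIntegralMonoid (x : complexIntegralMonoid) :
    (x : ℂ) / ((‖(x : ℂ)‖ : ℝ) : ℂ) ∈ complexIntegralMonoid := by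
  rw [mem_complexIntegralMonoid_iff, norm_div, Complex.norm_of_nonneg (norm_nonneg _),
    div_self (complexIntegralMonoid.norm_pos x).ne']
  exact ⟨one_pos, le_rfl⟩

/-- The inverse angular part `‖z‖/z` of `z ∈ 𝒪_ℂ^▷` lies in `𝒪_ℂ^▷` (on the unit circle).
[cite: MochizukiAbsTopIII2015, Def 5.6 (i) p. 134] -/
theorem norm_div_mem_complexIntegralMonoid (x : complexIntegralMonoid) :
    ((‖(x : ℂ)‖ : ℝ) : ℂ) / (x : ℂ) ∈ complexIntegralMonoid := by
  rw [mem_complexIntegralMonoid_iff, norm_div, Complex.norm_of_nonneg (norm_nonneg _),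
    div_self (complexIntegralMonoid.norm_pos x).ne']
  exact ⟨one_pos, le_rfl⟩

/-- The units of `𝒪_ℂ^▷` lie on the unit circle: `‖u‖ = 1` for `u ∈ (𝒪_ℂ^▷)^×` ("`C^×`", Def 5.6 (i)).
[cite: MochizukiAbsTopIII2015, Def 5.6 (i) p. 134] -/
theorem complexIntegralMonoid.norm_coe_units (u : (↥complexIntegralMonoid)ˣ) :
    ‖((u : complexIntegralMonoid) : ℂ)‖ = 1 := by
  have h : ((u : complexIntegralMonoid) : ℂ) * ((↑u⁻¹ : complexIntegralMonoid) : ℂ) = 1 := by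
    rw [← Submonoid.coe_mul, Units.mul_inv, Submonoid.coe_one]
  exact norm_eq_one_of_mul_eq_one (complexIntegralMonoid.norm_le_one _)
    (complexIntegralMonoid.norm_le_one _) h

/-! ## The model object of `TM⊢` -/

/-- **`TM⊢` is non-empty — GENUINE MODEL** ([AbsTopIII] Def 5.6 (i), NV-L4 row «TMMono»): the pair
`(C, C⃗) = (𝒪_ℂ^▷, 𝒪_ℂ^▷ ∩ ℝ_{>0})` with `C := complexIntegralMonoid = {z ∈ ℂ : 0 < ‖z‖ ≤ 1}` (subspace topology,
multiplication of `ℂ`), `C⃗ := {z ∈ C : Im z = 0, Re z > 0} = (0, 1]`, the identity `C ≅ 𝒪_ℂ^▷`, and the printed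
condition "the natural inclusions `C^× ↪ C`, `C⃗ ↪ C` determine an isomorphism `C^× × C⃗ ⥲ C` of topological
monoids" PROVED as `IsHomeomorph (u, t) ↦ u·t`: its continuous inverse is the polar decomposition
`z ↦ (z/‖z‖, ‖z‖)` (the units of `𝒪_ℂ^▷` are exactly the unit circle). Model named in full: this is the
archimedean object `(𝒪^▷_{A_X}, 𝒪^▷_{A_X} ∩ ℝ_{>0})` of Def 5.6 (ii)(c) for `A_X = ℂ`.
[cite: MochizukiAbsTopIII2015, Def 5.6 (i) p. 134] -/
theorem TMMono.nonempty_model : Nonempty TMMono.{0} := by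
  classical
  -- the ray `C⃗ = (0, 1] ⊆ 𝒪_ℂ^▷`
  let P : Submonoid complexIntegralMonoid :=
    { carrier := {x | (x : ℂ).im = 0 ∧ 0 < (x : ℂ).re}
      mul_mem' := by
        rintro a b ⟨ha0, ha1⟩ ⟨hb0, hb1⟩
        refine ⟨?_, ?_⟩
        · show (((a : ℂ) * (b : ℂ))).im = 0
          rw [Complex.mul_im, ha0, hb0, mul_zero, zero_mul, add_zero]
        · show 0 < (((a : ℂ) * (b : ℂ))).re
          rw [Complex.mul_re, ha0, hb0, mul_zero, sub_zero]
          exact mul_pos ha1 hb1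
      one_mem' := by
        refine ⟨?_, ?_⟩
        · show ((1 : ℂ)).im = 0
          exact Complex.one_im
        · show 0 < ((1 : ℂ)).re
          rw [Complex.one_re]
          exact one_pos }
  have hP : ∀ x : complexIntegralMonoid, x ∈ P ↔ (x : ℂ).im = 0 ∧ 0 < (x : ℂ).re := fun x => Iff.rfl
  -- an element of the ray is the real number `Re t = ‖t‖`
  have hP_eq : ∀ t : P, ((t : complexIntegralMonoid) : ℂ) = ((((t : complexIntegralMonoid) : ℂ).re : ℝ) : ℂ) := by
    intro t
    obtain ⟨him, -⟩ := (hP _).1 t.2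
    exact Complex.ext (by simp) (by simp [him])
  have hP_norm : ∀ t : P, ‖((t : complexIntegralMonoid) : ℂ)‖ = ((t : complexIntegralMonoid) : ℂ).re := by
    intro t
    obtain ⟨-, hre⟩ := (hP _).1 t.2
    rw [hP_eq t, Complex.norm_of_nonneg hre.le, Complex.ofReal_re]
  -- the radial part `z ↦ ‖z‖ ∈ C⃗`
  have rad_mem : ∀ z : complexIntegralMonoid,
      (⟨(((‖(z : ℂ)‖ : ℝ) : ℂ)), norm_mem_complexIntegralMonoid z⟩ : complexIntegralMonoid) ∈ P := by
    intro z
    rw [hP]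
    exact ⟨Complex.ofReal_im _, by rw [Complex.ofReal_re]; exact complexIntegralMonoid.norm_pos z⟩
  let rad : complexIntegralMonoid → P := fun z => ⟨⟨_, norm_mem_complexIntegralMonoid z⟩, rad_mem z⟩
  -- the angular part `z ↦ z/‖z‖ ∈ C^×`, with inverse `‖z‖/z`
  let ang : complexIntegralMonoid → (↥complexIntegralMonoid)ˣ := fun z =>
    ⟨⟨(z : ℂ) / ((‖(z : ℂ)‖ : ℝ) : ℂ), div_norm_mem_complexIntegralMonoid z⟩,
      ⟨((‖(z : ℂ)‖ : ℝ) : ℂ) / (z : ℂ), norm_div_mem_complexIntegralMonoid z⟩,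
      Subtype.ext (by
        show (z : ℂ) / ((‖(z : ℂ)‖ : ℝ) : ℂ) * (((‖(z : ℂ)‖ : ℝ) : ℂ) / (z : ℂ)) = 1
        rw [div_mul_div_comm, mul_comm (z : ℂ),
          div_self (mul_ne_zero (complexIntegralMonoid.ofReal_norm_ne_zero z)
            (complexIntegralMonoid.coe_ne_zero z))]),
      Subtype.ext (by
        show ((‖(z : ℂ)‖ : ℝ) : ℂ) / (z : ℂ) * ((z : ℂ) / ((‖(z : ℂ)‖ : ℝ) : ℂ)) = 1
        rw [div_mul_div_comm, mul_comm ((‖(z : ℂ)‖ : ℝ) : ℂ),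
          div_self (mul_ne_zero (complexIntegralMonoid.coe_ne_zero z)
            (complexIntegralMonoid.ofReal_norm_ne_zero z))])⟩
  -- continuity of the polar decomposition
  have hnormC : Continuous fun z : complexIntegralMonoid => ((‖(z : ℂ)‖ : ℝ) : ℂ) :=
    Complex.continuous_ofReal.comp (continuous_norm.comp continuous_subtype_val)
  have hrad : Continuous rad := by
    refine Continuous.subtype_mk (Continuous.subtype_mk hnormC _) _
  have hang : Continuous ang := by
    refine Units.continuous_iff.2 ⟨?_, ?_⟩
    · exact Continuous.subtype_mk
        (continuous_subtype_val.div hnormC complexIntegralMonoid.ofReal_norm_ne_zero) _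
    · exact Continuous.subtype_mk
        (hnormC.div continuous_subtype_val complexIntegralMonoid.coe_ne_zero) _
  -- `(u, t) ↦ u·t` is a homeomorphism `C^× × C⃗ ≅ C`
  have hhom : IsHomeomorph (fun x : (↥complexIntegralMonoid)ˣ × P =>
      (x.1 : complexIntegralMonoid) * (x.2 : complexIntegralMonoid)) := by
    refine isHomeomorph_iff_exists_inverse.2 ⟨?_, fun z => (ang z, rad z), ?_, ?_, hang.prodMk hrad⟩
    · exact (Units.continuous_val.comp continuous_fst).mul (continuous_subtype_val.comp continuous_snd)
    · -- left inverse: `(u·t/‖u·t‖, ‖u·t‖) = (u, t)`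
      rintro ⟨u, t⟩
      have hu : ‖((u : complexIntegralMonoid) : ℂ)‖ = 1 := complexIntegralMonoid.norm_coe_units u
      have hnorm : ‖(((u : complexIntegralMonoid) * (t : complexIntegralMonoid) : complexIntegralMonoid) : ℂ)‖
          = ((t : complexIntegralMonoid) : ℂ).re := by
        rw [Submonoid.coe_mul, norm_mul, hu, one_mul, hP_norm t]
      have hre : (((t : complexIntegralMonoid) : ℂ).re : ℂ) ≠ 0 :=
        Complex.ofReal_ne_zero.2 ((hP _).1 t.2).2.ne'
      refine Prod.ext ?_ ?_
      · refine Units.ext (Subtype.ext ?_)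
        show (((u : complexIntegralMonoid) * (t : complexIntegralMonoid) : complexIntegralMonoid) : ℂ) /
            ((‖(((u : complexIntegralMonoid) * (t : complexIntegralMonoid) : complexIntegralMonoid) : ℂ)‖ : ℝ) : ℂ)
            = ((u : complexIntegralMonoid) : ℂ)
        rw [hnorm, Submonoid.coe_mul, ← hP_eq t, mul_div_assoc, div_self (by rw [hP_eq t]; exact hre), mul_one]
      · refine Subtype.ext (Subtype.ext ?_)
        show (((‖(((u : complexIntegralMonoid) * (t : complexIntegralMonoid) : complexIntegralMonoid) : ℂ)‖ : ℝ) : ℂ))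
            = ((t : complexIntegralMonoid) : ℂ)
        rw [hnorm, ← hP_eq t]
    · -- right inverse: `(z/‖z‖)·‖z‖ = z`
      intro z
      refine Subtype.ext ?_
      show (z : ℂ) / ((‖(z : ℂ)‖ : ℝ) : ℂ) * ((‖(z : ℂ)‖ : ℝ) : ℂ) = (z : ℂ)
      exact div_mul_cancel₀ _ (complexIntegralMonoid.ofReal_norm_ne_zero z)
  exact ⟨{ C := complexIntegralMonoid
           pos := P
           exists_iso := ⟨MulEquiv.refl _, continuous_id, continuous_id⟩
           isHomeomorph_mul := hhom }⟩

/-- **The mono-analyticization datum is inhabited — DEGENERATE witness** ([AbsTopIII] Def 5.6 (ii)(c), NV-L4 row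
«ArchMonoAnalyticization»; honestly labelled): the CONSTANT assignment `X ↦ M₀`, `(X ≅ Y) ↦ id_{M₀}` at a fixed
object `M₀ ∈ Ob(TM⊢)` (inhabited by `TMMono.nonempty_model`, the archimedean model `(𝒪_ℂ^▷, 𝒪_ℂ^▷ ∩ ℝ_{>0})`).
Degenerate because it ignores `X`: the genuine functor `X ↦ (𝒪^▷_{A_X}, 𝒪^▷_{A_X} ∩ ℝ_{>0})` requires the Cor 2.9
identification `A_X ≅ ℂ` as data on the stub `AutHolOrbispace` (GaloisTheaters.lean; TODO-merge abc-iut-L4-t2),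
which records `A_X` only as an abstract topological field; for the intended objects the constant value is the
printed one. [cite: MochizukiAbsTopIII2015, Def 5.6 (ii) p. 135] -/
theorem ArchMonoAnalyticization.nonempty_degenerate : Nonempty ArchMonoAnalyticization.{0} :=
  ⟨{ toTMMono := fun _ => Classical.choice TMMono.nonempty_model
     mapIso := fun _ => TMMono.Iso.refl _ }⟩

end Literature.AnabelianGeometry.AbsoluteAnabelian
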